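import Summits.ABC.IUTFork.Thm311RealInd1StripTwistPlanesJW
import Summits.ABC.IUTFork.Thm311RealGaloisLogAnalytic
import Literature.AnabelianGeometry.AbsoluteAnabelian.MLFGaloisJannsenWingbergTwists
import Literature.AnabelianGeometry.AbsoluteAnabelian.MonoAnalyticLiftNormCompat
import Literature.IUT.LogVolume.LogShellTopology
import HarnessLib

/-!
# [IUTchIII] Thm 3.11 (i) (Ind1) at `v ∈ 𝕍^non`: the Jannsen–Wingberg KIT — THE equivariant lift read through the
# reciprocity map, and the analytic lemmas that turn topological generation of `𝒪_v^≺` into statements about `log`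

PROOF-ONLY file (abc-iut cell, Cor. 3.12 sub-crew, seat abc-iut-c312-1 = holder of record of the typed [IUTchIII] Thm. 3.11,
gen 11; row «R12 JW-TWISTS-FROM-PRESENTATION», part a).  TAKES NO SIDE on [IUTchIII] Cor. 3.12.

The named fact `DehnTwistTransvectionsOnUnitsAll` (this lineage, gen 9) recorded K. Kondo's `k_+`-LEVEL sentence «`(φ_i)_+`
is the elementary transvection `y_b ↦ y_b + y_a`» (arXiv:2512.09231, proof of Thm. 2.3 p. 10).  Gen 11 replaces it, for
every completion `K_v` of a number field, by a THEOREM from the GROUP-LEVEL fact `JannsenWingbergTwists` (Jannsen–Wingberg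
generators of `G_k` read through the tree's reciprocity map `θ`, + the twists `x_b ↦ x_b x_a` of the presentation).  This
file is the first half of the kit.

* `mul_conj_mul_self_eq`, `mul_inv_conj_eq` — the verification «`ψ(r) = r`» of Jannsen–Wingberg §5.1 p. 96: the commutator
  identities `[a, b·a] = [a, b]`, `[a·b⁻¹, b] = [a, b]` (the twists touch the relation through one commutator only).
* **`Real.theta_unitsToK_liftUnits`** — THE equivariant lift of `φ ∈ Aut_top(G_v)` ([AbsTopIII] Prop. 3.2 (iv), this
  lineage's `Real.liftUnits v φ` on `𝒪_v^×`) IS `θ⁻¹ ∘ φ^{ab} ∘ θ`: `θ(liftUnits φ u) = φ^{ab}(θ u)` for THE canonical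
  reciprocity map `θ` of the tree (abc-iut-L4-d1's `Cor110iiPrime.exists_theta_unitsTransport` + L6-t13's
  `Prop121vii.liftM_coe_eq_of_unitsTransport`, both BY NAME).
* `Real.exists_toOUnits_coe_eq_of_isUnit` — a unit of `𝒪^⊳_{K̄_v}` lying over `K_v` is (the image of) a unit of `𝒪_v`.
* `Real.norm_of_galoisLog_le`, `Real.exists_unit_of_galoisLog_eq_of_norm_le`, `Real.exists_pow_sub_one_lt` — the Galois
  logarithm (= abc-iut-S1's analytic `log_p`, `Real.galoisLog_apply_eq_unitLog`) has BOUNDED image containing a BALL, and every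
  unit has a principal power (abc-iut-S1's `isCompact_logUnits` / `closedBall_subset_logUnits` / `exists_pow_isPrincipal`).
* `Real.exists_mem_closure_mul_pow` — topological generation in `K_vˣ` ⟹ `w = d · z^N` with `d` in the generated subgroup
  (`(𝒪_v^×)^N` is open: this lineage's `isOpen_map_range_powMonoidHom`).
(The sequel `Thm311RealInd1StripTwistJWSpan` draws the two consequences — `log ∘ liftUnits φ = T ∘ log` from generators, and
the spanning half of Hoshi–Nishio's Lemma 1.3; `Thm311RealInd1StripTwistJW` assembles the theorem.)
HONEST SCOPE: classical facts about one completion `K_v`; nothing here asserts or refutes [IUTchIII] Cor. 3.12.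
[claim: Mochizuki2012, status: disputed] for the (Ind1) vocabulary; [cite: HoshiNishio2022OuterAutMLF, Lemma 1.3];
[cite: Kondo2025OuterAutMLF, §2 proof of Thm 2.3 p.10]; [cite: JannsenWingberg1982, §5.1 p.96].  typed ≠ proved.
-/

set_option autoImplicit false

noncomputable section

open Metric Set
open scoped Pointwise

namespace Summit.ABC.IUTFork.Thm311.Real

open NumberField IsDedekindDomain Literature.NumberTheory.NumberFields Literature.IUT.LogVolume
open Literature.NumberTheory.GaloisRepresentations
open Literature.AnabelianGeometry.AbsoluteAnabelian Literature.IUT.HodgeArakelov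
open Literature.IUT.HodgeArakelov.AbsTopMonoids

variable {F : Type} [Field F] [NumberField F] (v : HeightOneSpectrum (𝓞 F))

/-! ## 0. «`ψ(r) = r`»: the twists fix the commutator they touch (Jannsen–Wingberg §5.1 p. 96 l. 57–60) -/

/-- `[a, b·a] = [a, b]` in any group (`[g, h] = g h g⁻¹ h⁻¹`): the substitution `x_b ↦ x_b x_a` fixes `[x_a, x_b]`, hence the
Jannsen–Wingberg relation — «da `ψ(r) = r` gilt». [cite: JannsenWingberg1982, §5.1 p.96] -/
theorem mul_conj_mul_self_eq {G : Type*} [Group G] (a b : G) : a * (b * a) * a⁻¹ * (b * a)⁻¹ = a * b * a⁻¹ * b⁻¹ := by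
  rw [mul_inv_rev, ← mul_assoc, ← mul_assoc a b a, mul_assoc (a * b) a a⁻¹, mul_inv_cancel, mul_one]

/-- `[a·b⁻¹, b] = [a, b]` in any group: Kondo's `φ'_i : x_a ↦ x_a x_b⁻¹` fixes `[x_a, x_b]`.
[cite: Kondo2025OuterAutMLF, §2 proof of Thm 2.3 p.10] -/
theorem mul_inv_conj_eq {G : Type*} [Group G] (a b : G) : a * b⁻¹ * b * (a * b⁻¹)⁻¹ * b⁻¹ = a * b * a⁻¹ * b⁻¹ := by
  rw [mul_inv_rev, inv_inv, inv_mul_cancel_right, ← mul_assoc]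

/-! ## 1. THE equivariant lift on `𝒪_v^×` is `θ⁻¹ ∘ φ^{ab} ∘ θ` -/

/-- **`θ(liftUnits v φ u) = φ^{ab}(θ u)`** for THE canonical local reciprocity map `θ : K_vˣ → G_v^{ab}` of the tree and every
`φ ∈ Aut_top(G_v)`, `u ∈ 𝒪_v^×`: THE `φ`-equivariant lift of [AbsTopIII] Prop. 3.2 (iv) acts on base units as the reciprocity
transport `Art⁻¹ ∘ φ^{ab} ∘ Art` of [AbsAnab] Prop. 1.2.1 (iii)/(vi) (`Prop121vii.unitsTransport_holds`,
`liftM_coe_eq_of_unitsTransport`, `Cor110iiPrime.exists_theta_unitsTransport`). [cite: MochizukiAbsAnab2004, Prop 1.2.1 (iii) p.11] -/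
theorem theta_unitsToK_liftUnits (φ : Gal v ≃ₜ* Gal v) (u : (↥(v.adicCompletionIntegers F))ˣ) :
    haveI : CharZero (v.adicCompletion F) := charZero_adicCompletion v
    haveI : ValuativeExtension (v.adicCompletion F) (v.adicCompletion F) := ⟨fun _ _ => Iff.rfl⟩
    (LocalWeilDatum.isReciprocitySystemE (F := v.adicCompletion F) (E := v.adicCompletion F)
        (LocalWeilDatum.isClassFieldTheory_localWeilDatum (v.adicCompletion F))).theta (unitsToK v (liftUnits v φ u)) =
      abelianizationCongr φ
        ((LocalWeilDatum.isReciprocitySystemE (F := v.adicCompletion F) (E := v.adicCompletion F)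
          (LocalWeilDatum.isClassFieldTheory_localWeilDatum (v.adicCompletion F))).theta (unitsToK v u)) := by
  haveI : CharZero (v.adicCompletion F) := charZero_adicCompletion v
  haveI : ValuativeExtension (v.adicCompletion F) (v.adicCompletion F) := ⟨fun _ _ => Iff.rfl⟩
  -- THE units transport `ψ̄` of [AbsAnab] Prop. 1.2.1 and `liftM = ψ̄` on `𝒪^⊳`
  obtain ⟨ψ, hψ, hU, hπ⟩ := Prop121vii.unitsTransport_holds (v.adicCompletion F) (v.adicCompletion F) φ
  have hval := val_toOUnits v u
  have hu : algebraMap (v.adicCompletion F) (AlgebraicClosure (v.adicCompletion F))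
      ((u : ↥(v.adicCompletionIntegers F)) : v.adicCompletion F) ∈
        nonzeroIntegers (v.adicCompletion F) (AlgebraicClosure (v.adicCompletion F)) := by
    rw [← hval]
    exact ((toOUnits v u : OUnits v) :
      nonzeroIntegers (v.adicCompletion F) (AlgebraicClosure (v.adicCompletion F))).2
  have harg : ((toOUnits v u : OUnits v) :
      nonzeroIntegers (v.adicCompletion F) (AlgebraicClosure (v.adicCompletion F))) = ⟨_, hu⟩ :=
    Subtype.ext hval
  have heq := coe_liftM_toOUnits v φ u
  rw [harg] at heq
  have hlift := Prop121vii.liftM_coe_eq_of_unitsTransport hψ hU hπ ⟨_, hu⟩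
  -- `ψ̄ (ι u) = ι (liftUnits v φ u)`
  have hψu : ((ψ (Units.map (algebraMap (v.adicCompletion F) (AlgebraicClosure (v.adicCompletion F)) :
      v.adicCompletion F →* AlgebraicClosure (v.adicCompletion F)) (unitsToK v u)) : (AlgebraicClosure (v.adicCompletion F))ˣ) :
        AlgebraicClosure (v.adicCompletion F)) =
      algebraMap (v.adicCompletion F) (AlgebraicClosure (v.adicCompletion F))
        ((liftUnits v φ u : ↥(v.adicCompletionIntegers F)) : v.adicCompletion F) := by
    have hmk : Units.map (algebraMap (v.adicCompletion F) (AlgebraicClosure (v.adicCompletion F)) :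
        v.adicCompletion F →* AlgebraicClosure (v.adicCompletion F)) (unitsToK v u) =
        Units.mk0 (algebraMap (v.adicCompletion F) (AlgebraicClosure (v.adicCompletion F))
          ((u : ↥(v.adicCompletionIntegers F)) : v.adicCompletion F)) hu.2 := Units.ext rfl
    rw [hmk]
    exact hlift.symm.trans heq
  -- the reciprocity transport at the bottom level
  obtain ⟨b, hb, hθ⟩ := Cor110iiPrime.exists_theta_unitsTransport φ hψ hπ (unitsToK v u)
  have hb' : b = unitsToK v (liftUnits v φ u) := by
    apply Units.ext
    apply (algebraMap (v.adicCompletion F) (AlgebraicClosure (v.adicCompletion F))).injective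
    have h : ((ψ (Units.map (algebraMap (v.adicCompletion F) (AlgebraicClosure (v.adicCompletion F)) :
        v.adicCompletion F →* AlgebraicClosure (v.adicCompletion F)) (unitsToK v u)) : (AlgebraicClosure (v.adicCompletion F))ˣ) :
          AlgebraicClosure (v.adicCompletion F)) =
        algebraMap (v.adicCompletion F) (AlgebraicClosure (v.adicCompletion F)) (b : v.adicCompletion F) := by
      rw [hb]; rfl
    rw [← h, hψu]
    rfl
  rw [← hb']
  exact hθ

/-- **`[x] = θ u` is transported**: if `absGaloisAbProj (x) = θ (unitsToK u)` and `absGaloisAbProj (φ x) = θ (unitsToK u')`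
then `liftUnits v φ u = u'` (`θ` is injective — the tree's `theta_injective` with `universalNormSubgroup_eq_bot`).
[cite: MochizukiAbsAnab2004, Prop 1.2.1 (iii) p.11] -/
theorem liftUnits_eq_of_theta (φ : Gal v ≃ₜ* Gal v) {x : Gal v} {u u' : (↥(v.adicCompletionIntegers F))ˣ}
    (hx : haveI : ValuativeExtension (v.adicCompletion F) (v.adicCompletion F) := ⟨fun _ _ => Iff.rfl⟩
      absGaloisAbProj (v.adicCompletion F) x =
        (LocalWeilDatum.isReciprocitySystemE (F := v.adicCompletion F) (E := v.adicCompletion F)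
          (LocalWeilDatum.isClassFieldTheory_localWeilDatum (v.adicCompletion F))).theta (unitsToK v u))
    (hx' : haveI : ValuativeExtension (v.adicCompletion F) (v.adicCompletion F) := ⟨fun _ _ => Iff.rfl⟩
      absGaloisAbProj (v.adicCompletion F) (φ x) =
        (LocalWeilDatum.isReciprocitySystemE (F := v.adicCompletion F) (E := v.adicCompletion F)
          (LocalWeilDatum.isClassFieldTheory_localWeilDatum (v.adicCompletion F))).theta (unitsToK v u')) :
    liftUnits v φ u = u' := by
  haveI : ValuativeExtension (v.adicCompletion F) (v.adicCompletion F) := ⟨fun _ _ => Iff.rfl⟩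
  have h := theta_unitsToK_liftUnits v φ u
  rw [← hx] at h
  change _ = abelianizationCongr φ (QuotientGroup.mk x) at h
  rw [abelianizationCongr_mk] at h
  change _ = absGaloisAbProj (v.adicCompletion F) (φ x) at h
  rw [hx'] at h
  exact unitsToK_injective v
    ((LocalWeilDatum.isReciprocitySystemE (F := v.adicCompletion F) (E := v.adicCompletion F)
      (LocalWeilDatum.isClassFieldTheory_localWeilDatum (v.adicCompletion F))).theta_injective
      (universalNormSubgroup_eq_bot (v.adicCompletion F)) h)

/-! ## 2. Units of `𝒪^⊳_{K̄_v}` over `K_v` are units of `𝒪_v` -/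

/-- A UNIT `x` of the monoid `𝒪^⊳_{K̄_v}` whose underlying element is `ι a`, `a ∈ K_v`, is the image `toOUnits v w` of a unit
`w ∈ 𝒪_v^×` with `w = a` (`O^×(G_v)^{G_v} = 𝒪_v^×`, `Real.mem_fixedBy_top_iff`). [cite: MochizukiAbsTopIII2015, Definition 3.1 (iv) p.69] -/
theorem exists_toOUnits_coe_eq_of_isUnit
    {x : (ModelMLFGaloisData.galois (v.adicCompletion F) (AlgebraicClosure (v.adicCompletion F))).tmPair.M}
    (hx : IsUnit x) {a : v.adicCompletion F}
    (hxa : ((x : nonzeroIntegers (v.adicCompletion F) (AlgebraicClosure (v.adicCompletion F))) :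
      AlgebraicClosure (v.adicCompletion F)) = algebraMap (v.adicCompletion F) (AlgebraicClosure (v.adicCompletion F)) a) :
    ∃ w : (↥(v.adicCompletionIntegers F))ˣ,
      ((toOUnits v w : OUnits v) : nonzeroIntegers (v.adicCompletion F) (AlgebraicClosure (v.adicCompletion F))) = x ∧
      ((w : ↥(v.adicCompletionIntegers F)) : v.adicCompletion F) = a := by
  obtain ⟨xu, hxu⟩ := hx
  have hfix : xu ∈ fixedBy (galRho v) ⊤ := by
    rw [mem_fixedBy]
    intro σ _
    apply Units.ext; apply Subtype.ext
    rw [coe_galRho, hxu, hxa]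
    exact σ.commutes a
  obtain ⟨w, hw⟩ := (mem_fixedBy_top_iff v xu).mp hfix
  refine ⟨w, by rw [← hw, hxu], ?_⟩
  apply (algebraMap (v.adicCompletion F) (AlgebraicClosure (v.adicCompletion F))).injective
  rw [← val_toOUnits v w, ← hxa, ← hxu, hw]

/-! ## 3. Analytic lemmas: the Galois logarithm in the rescaled norm `K_v^{(1/n_v)}` -/

section Analytic

variable (p : ℕ) [hp : Fact p.Prime] (hv : ((p : ℕ) : 𝓞 F) ∈ v.asIdeal)

/-- `log(u) ∈ log_p(R^×)` in the rescaled completion (`Real.galoisLog_apply_eq_unitLog`). [cite: NeukirchANT1999, Ch. II Prop. (5.5)] -/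
theorem of_galoisLog_mem_logUnits (u : (↥(v.adicCompletionIntegers F))ˣ) :
    RescaledCompletion.of F p v hv (galoisLog v (Additive.ofMul u)) ∈ logUnits (RescaledCompletion F p v hv) := by
  rw [galoisLog_apply_eq_unitLog v p hv u, RingEquiv.apply_symm_apply]
  exact unitLog_mem_logUnits (norm_of_coe_unit_eq_one v p hv u)

/-- **The Galois logarithm has BOUNDED image**: `‖log u‖ ≤ C` for all `u ∈ 𝒪_v^×` (`log_p(R^×)` is compact,
abc-iut-S1's `isCompact_logUnits`). [cite: NeukirchANT1999, Ch. II Prop. (5.5)] -/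
theorem exists_norm_of_galoisLog_le :
    ∃ C : ℝ, 0 ≤ C ∧ ∀ u : (↥(v.adicCompletionIntegers F))ˣ,
      ‖RescaledCompletion.of F p v hv (galoisLog v (Additive.ofMul u))‖ ≤ C := by
  obtain ⟨C, hC⟩ := (isCompact_logUnits p (RescaledCompletion F p v hv)).isBounded.exists_norm_le
  refine ⟨max C 0, le_max_right _ _, fun u => (hC _ (of_galoisLog_mem_logUnits v p hv u)).trans (le_max_left _ _)⟩

/-- **The image of the Galois logarithm contains a BALL**: every `z` with `‖z‖ ≤ p⁻²` is `log u` for some `u ∈ 𝒪_v^×`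
(abc-iut-S1's `closedBall_subset_logUnits`). [cite: NeukirchANT1999, Ch. II Prop. (5.5)] -/
theorem exists_unit_of_galoisLog_eq_of_norm_le {z : RescaledCompletion F p v hv} (hz : ‖z‖ ≤ (p : ℝ) ^ (-(2 : ℝ))) :
    ∃ u : (↥(v.adicCompletionIntegers F))ˣ, RescaledCompletion.of F p v hv (galoisLog v (Additive.ofMul u)) = z := by
  obtain ⟨y, hy, hyz⟩ := closedBall_subset_logUnits p (RescaledCompletion F p v hv) (by exact hz)
  rw [Set.mem_setOf_eq] at hy
  -- `y = of x` with `‖x‖ = 1`, i.e. `x ∈ 𝒪_v^×`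
  set x : v.adicCompletion F := (RescaledCompletion.of F p v hv).symm y with hx
  have hyx : y = RescaledCompletion.of F p v hv x := by rw [hx, RingEquiv.apply_symm_apply]
  have hx1 : ‖x‖ = 1 := by
    have h := hy
    rw [hyx, RescaledCompletion.norm_of] at h
    have hpos : 0 < (1 / (localDeg F v : ℝ)) := div_pos one_pos (by exact_mod_cast localDeg_pos F v)
    rcases lt_trichotomy ‖x‖ 1 with hlt | heq | hgt
    · exact absurd h (ne_of_lt (Real.rpow_lt_one (norm_nonneg _) hlt hpos))
    · exact heq
    · exact absurd h (ne_of_gt (Real.one_lt_rpow hgt hpos))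
  have hxO : x ∈ v.adicCompletionIntegers F := by
    rw [HeightOneSpectrum.mem_adicCompletionIntegers]
    exact Valued.toNormedField.norm_le_one_iff.mp hx1.le
  have hx0 : x ≠ 0 := by intro h; rw [h, norm_zero] at hx1; exact zero_ne_one hx1
  have hxiO : x⁻¹ ∈ v.adicCompletionIntegers F := by
    rw [HeightOneSpectrum.mem_adicCompletionIntegers]
    exact Valued.toNormedField.norm_le_one_iff.mp (by rw [norm_inv, hx1, inv_one])
  let u : (↥(v.adicCompletionIntegers F))ˣ :=
    ⟨⟨x, hxO⟩, ⟨x⁻¹, hxiO⟩, Subtype.ext (mul_inv_cancel₀ hx0), Subtype.ext (inv_mul_cancel₀ hx0)⟩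
  refine ⟨u, ?_⟩
  rw [galoisLog_apply_eq_unitLog v p hv u, RingEquiv.apply_symm_apply, ← hyz, hyx]

include hp hv in
/-- **Every unit has a principal power**: for `w ∈ 𝒪_v^×` there is `k > 0` with `|w^k − 1|_v < 1` (abc-iut-S1's
`exists_pow_isPrincipal` in the rescaled norm; classically `w^{q−1} ∈ U^{(1)}`). [cite: NeukirchANT1999, Ch. II (5.3)] -/
theorem exists_pow_sub_one_lt (w : (↥(v.adicCompletionIntegers F))ˣ) :
    ∃ k : ℕ, 0 < k ∧ ValuativeRel.valuation (v.adicCompletion F)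
      ((((w ^ k : (↥(v.adicCompletionIntegers F))ˣ) : ↥(v.adicCompletionIntegers F)) : v.adicCompletion F) - 1) < 1 := by
  obtain ⟨k, hk, hP⟩ := exists_pow_isPrincipal (K := RescaledCompletion F p v hv) (norm_of_coe_unit_eq_one v p hv w)
  refine ⟨k, hk, ?_⟩
  -- `‖1 − (of w)^k‖ < 1` read back in `K_v`
  have h1 : ‖RescaledCompletion.of F p v hv
      ((((w ^ k : (↥(v.adicCompletionIntegers F))ˣ) : ↥(v.adicCompletionIntegers F)) : v.adicCompletion F) - 1)‖ < 1 := by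
    rw [Units.val_pow_eq_pow_val, SubmonoidClass.coe_pow, map_sub, map_pow, map_one, ← norm_neg, neg_sub]
    exact hP
  rw [RescaledCompletion.norm_of] at h1
  have h2 : ‖(((w ^ k : (↥(v.adicCompletionIntegers F))ˣ) : ↥(v.adicCompletionIntegers F)) : v.adicCompletion F) - 1‖ < 1 := by
    by_contra hle
    rw [not_lt] at hle
    have : (1 : ℝ) ≤ ‖(((w ^ k : (↥(v.adicCompletionIntegers F))ˣ) : ↥(v.adicCompletionIntegers F)) : v.adicCompletion F) - 1‖ ^
        (1 / (localDeg F v : ℝ)) := Real.one_le_rpow hle (by positivity)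
    exact absurd h1 (not_lt.mpr this)
  have h3 := Valued.toNormedField.norm_lt_one_iff.mp h2
  exact ((ValuativeRel.isEquiv (ValuativeRel.valuation (v.adicCompletion F))
    (Valued.v : Valuation (v.adicCompletion F) (WithZero (Multiplicative ℤ)))).lt_one_iff_lt_one).mpr h3

/-- `p`-adic limits: if `‖a‖ ≤ ‖p‖^N · C` for every `N` then `a = 0`. [folklore] -/
theorem eq_zero_of_forall_norm_le_norm_prime_pow {a : RescaledCompletion F p v hv} {C : ℝ}
    (h : ∀ N : ℕ, ‖a‖ ≤ ‖(p : ℚ_[p])‖ ^ N * C) : a = 0 := by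
  by_contra ha
  have ha' : 0 < ‖a‖ := norm_pos_iff.mpr ha
  have hC : 0 ≤ C := by
    have h0 := h 0
    rw [pow_zero, one_mul] at h0
    exact ha'.le.trans h0
  have hlim : Filter.Tendsto (fun N : ℕ => ‖(p : ℚ_[p])‖ ^ N * C) Filter.atTop (nhds 0) := by
    have := (tendsto_pow_atTop_nhds_zero_of_lt_one (norm_nonneg _) (Padic.norm_p_lt_one (p := p))).mul_const C
    rwa [zero_mul] at this
  obtain ⟨N, hN⟩ := (Filter.Tendsto.eventually_lt_const ha' hlim).exists
  exact absurd (h N) (not_le.mpr hN)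

/-! ## 4. Topological generation in `K_vˣ` ⟹ factorisations `w = d · z^N` -/

/-- **Density ⟹ factorisation**: if `w ∈ 𝒪_v^×` lies in the closure (in `K_vˣ`) of the subgroup generated by `S ⊆ 𝒪_v^×`, then for
every `N ≠ 0` there are `d ∈ ⟨S⟩` and `z ∈ 𝒪_v^×` with `w = d · z^N` — because `(𝒪_v^×)^N` is OPEN (this lineage's
`isOpen_map_range_powMonoidHom`, Hensel). [folklore] -/
theorem exists_mem_closure_mul_pow (S : Set (↥(v.adicCompletionIntegers F))ˣ) {w : (↥(v.adicCompletionIntegers F))ˣ}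
    (hw : unitsToK v w ∈ (((Subgroup.closure S).map (unitsToK v)).topologicalClosure : Subgroup (v.adicCompletion F)ˣ))
    {N : ℕ} (hN : N ≠ 0) :
    ∃ d ∈ Subgroup.closure S, ∃ z : (↥(v.adicCompletionIntegers F))ˣ, w = d * z ^ N := by
  -- the open subgroup `O = (𝒪_v^×)^N` of `K_vˣ` and the open neighbourhood `w·O` of `w`
  set O : Subgroup (v.adicCompletion F)ˣ :=
    ((powMonoidHom N : (↥(v.adicCompletionIntegers F))ˣ →* _).range).map (unitsToK v) with hO
  have hOopen : IsOpen (O : Set (v.adicCompletion F)ˣ) := isOpen_map_range_powMonoidHom v hN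
  let U : Set (v.adicCompletion F)ˣ := (fun y => (unitsToK v w)⁻¹ * y) ⁻¹' (O : Set (v.adicCompletion F)ˣ)
  have hUopen : IsOpen U := hOopen.preimage (continuous_const_mul _)
  have hwU : unitsToK v w ∈ U := by
    change (unitsToK v w)⁻¹ * unitsToK v w ∈ O
    rw [inv_mul_cancel]; exact O.one_mem
  -- the closure meets `U`
  have hw' : unitsToK v w ∈ closure (((Subgroup.closure S).map (unitsToK v) : Subgroup (v.adicCompletion F)ˣ) :
      Set (v.adicCompletion F)ˣ) := by
    rw [← Subgroup.topologicalClosure_coe]; exact hw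
  obtain ⟨y, hyU, hyS⟩ := mem_closure_iff.mp hw' U hUopen hwU
  obtain ⟨d, hd, rfl⟩ := Subgroup.mem_map.mp hyS
  have hyU' : (unitsToK v w)⁻¹ * unitsToK v d ∈ O := hyU
  obtain ⟨o, ho, hoe⟩ := Subgroup.mem_map.mp hyU'
  obtain ⟨z, rfl⟩ := MonoidHom.mem_range.mp ho
  refine ⟨d, hd, z⁻¹, ?_⟩
  apply unitsToK_injective v
  rw [map_mul, map_pow, map_inv, inv_pow, ← map_pow, ← powMonoidHom_apply, hoe, mul_inv_rev, inv_inv,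
    ← mul_assoc, mul_inv_cancel, one_mul]

end Analytic

end Summit.ABC.IUTFork.Thm311.Real

end
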